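import Summits.QuantumFields.BalabanUV.Beta.GAN24.MonotoneCovLimit

/-!
# Beta / GAN24 / MonotoneTorusSoftLimit — THE HARD (δ-FUNCTION) AVERAGING CONSTRAINT IS THE `a′ → ∞` LIMIT OF THE SOFT (GAUSSIAN-WEIGHTED)
# ONE: `softPlaqCov k Rₛ a′ R_h → plaqCov (Rₛ ⊕ R_h) k` entrywise — the hard plaquette covariance is the INFIMUM of the soft ones, ATTAINED AS
# THE LIMIT (penalty-method limit for DEGENERATE forms; abstract, finite-dimensional; no rate)
# (gan24-p4 gen 6; BINDER-OWNERS row G-an2-4 ∕ (CONV-C), ALTERNATIVE DISCHARGE «rate OR monotonicity»; NOT IN PRINT — our proof attempt)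

HONEST FRAMING (page 1 of everything the β sub-cell writes): discharging `BetaPertH` makes Bałaban's UV stability UNCONDITIONAL — a
real constructive-QFT result; it is NOT the continuum limit and NOT the Clay problem.  HONEST DEPENDENCY (cell reorg 2026-08-19, verbatim):
«continuum YM on T⁴ ⇐ BetaPertH ∧ nine spine estimates (0/9 proved); BetaPertH ⇐ (D1) ∧ (D4) ∧ CAP+tail; G-an2-4 gates asym, D1 and NE2/3/4.»
HONEST LABEL: «not in print; our proof attempt; alternative discharge of the G-an2-4 row (rate OR monotonicity)»; 0 wall binders instantiated.
ABSOLUTE RULE honoured: nothing is cited; [folklore] finite-dimensional linear algebra and elementary real analysis over gen 2–5's `MonotoneCoarsen` ∕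
`MonotoneCritical` ∕ `MonotoneTorusSoft` ∕ `MonotoneCovLimit`; the printed `Δ_k` enters only through the TREE-typed `MonotoneTorusEffective.effAction`
(`= 2 • DelK (Lc^k)`, (1.65)) BY NAME.

## WHY ∕ WHAT (road P4; the optional cross-reader point NIT N1 of C-gan24leaf03-g25-1, journal l.12326, as a theorem)
`MonotoneTorusSoft` §5 proved THE SANDWICH `plaqCov (Rₛ ⊕ R_h) k ≤ softPlaqCov k Rₛ a′ R_h ≤ plaqCov R_h k` (`a′ ≥ 0`) and §3 that `softPlaqCov`
is antitone in `a′`; as a declaration its title «the hard constraint IS THE INFIMUM» was only the lower bound.  THIS FILE types the other half.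
* §1 sup-norm bookkeeping.  §2 **`weight_sub_critCov_eq_zero`**: inside `ker R_h` the canonical constrained pseudo-inverse of a PSD weight `S`
  reproduces `S v`; whence the CORRECTION `corr Rₛ R_h v := critCov (RₛᴴRₛ) R_h (RₛᴴRₛ v)`: `R_h (corr v) = 0`, **`Rₛ (v − corr v) = 0`**, and
  `corr v` is LINEAR IN `Rₛ v` (`corr_eq_mulVec`).
* §3 the penalised family `penForm H Rₛ a := H + a • RₛᴴRₛ` and **`pairing_critCov_penalty_tendsto`**: `H` PSD (degenerate allowed), rows `Rₛ, R_h`,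
  a source `r ⊥ ker H` ⟹ `⟨r, critCov (penForm H Rₛ a) R_h r⟩ → ⟨r, critCov H (Rₛ ⊕ R_h) r⟩` (`a → ∞`).  PENALTY METHOD: `p(a)` is antitone and
  `≥ p_hard`; the slack `s(a) = ‖Rₛv_a‖²` of the soft critical point obeys `(a − b)·s(a) ≤ p(b) − p(a)`; the competitor `v_a − corr v_a ∈ ker (Rₛ ⊕ R_h)`
  gives, by criticality (`⟨corr v_a, r − Hv_a⟩ = a·s(a)`), `p(a) − p_hard ≤ a·s(a) + ⟨corr v_a, H corr v_a⟩ ≤ (a + C)·s(a)`; so `p(a) − p_hard ≤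
  (2 + 2C)(p(a/2) − p(a)) → 0` (an antitone function bounded below converges).  **`readOut_critCov_penalty_tendsto`**: `T·critCov (penForm H Rₛ a) R_h·Tᴴ
  → T·critCov H (Rₛ ⊕ R_h)·Tᴴ` entrywise for every `T` killing `ker H` (polarisation).
* §4 (torus) **`softPlaqCov_tendsto_plaqCov_hardRows`**: `softPlaqCov k Rₛ a′ R_h i j → plaqCov (Rₛ ⊕ R_h) k i j` as `a′ → ∞`, every `k, Rₛ, R_h`,
  read-out torus, entry; **`le_plaqCov_hardRows_of_le_soft`**: a matrix below every `softPlaqCov k Rₛ a′ R_h` (`a′ ≥ 0`) is below `plaqCov (Rₛ ⊕ R_h) k`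
  — with gen 5's lower bound, the hard plaquette covariance IS the Loewner infimum of the Gaussian-weighted ones, attained as the limit.  Dictionary:
  Bałaban's averaging of record for the gauge field is the δ-function `δ(B − Q_kA)` ([B5] (1.12)∕(1.17)); the scalar template's Gaussian averaging
  `exp(−a′Σ|B′ − QB|²)` (Dimock, «The renormalization group according to Balaban I», §2.1) recovers it in the infinite-weight limit — here a theorem on
  the gauge-invariant (plaquette) content for Bałaban's DEGENERATE block action, where the limit is not the textbook positive-definite one.
No rate, no constant of the series, no datum value; torus avatar, `U = 1`; NOT (CONV-C), NOT BetaPertH, NOT continuum, NOT Clay.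
-/

noncomputable section

namespace Summit.QuantumFields.BalabanUV.Beta.GAN24.MonotoneTorusSoftLimit

open Matrix Filter Topology
open scoped ComplexOrder ComplexConjugate
open Literature.MathematicalPhysics.QuantumFieldTheory.Balaban1983to89.B5Prop11Plancherel (Tor)
open Summit.QuantumFields.BalabanUV.Beta.GAN24.MonotoneCoarsen (IsCrit qfun conj_pairing qfun_add qfun_le_of_isCrit qfun_crit_eq_pairing)
open Summit.QuantumFields.BalabanUV.Beta.GAN24.MonotoneCritical (hpinv kerProj kerProj_pairing kerProj_mulVec_of_mem_ker isHermitian_compress critCov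
  isCrit_critCov critCov_mem_ker mulVec_critCov_mem_ker mulVec_hpinv_mulVec_of_orth_ker)
open Summit.QuantumFields.BalabanUV.Beta.GAN24.MonotoneShorted (readOut_quad mem_ker_iff)
open Summit.QuantumFields.BalabanUV.Beta.GAN24.MonotoneTorusSoft (qfun_mono_form ker_of_ker_larger softForm_isHermitian softPlaqCov)
open Summit.QuantumFields.BalabanUV.Beta.GAN24.MonotoneCovLimit (norm_quad_le readOut_apply_polar posSemidef_of_tendsto)
open Summit.QuantumFields.BalabanUV.Beta.GAN24.MonotoneTorusTower (curlMat)
open Summit.QuantumFields.BalabanUV.Beta.GAN24.MonotoneTorusPlaquette (plaqCov)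
open Summit.QuantumFields.BalabanUV.Beta.GAN24.MonotoneTorusEffective (effAction effAction_isHermitian effAction_posSemidef
  curlMat_of_effAction_ker plaqCov_eq_critCov_effAction critCov_congr)

/-! ## §1 Weights and sup-norm bookkeeping -/

section Norms

variable {ι κ : Type*} [Fintype ι] [Fintype κ]

/-- The averaging weight `RₛᴴRₛ` is positive semidefinite. [folklore] -/
theorem weight_posSemidef (Rs : Matrix ι κ ℂ) : (Rsᴴ * Rs).PosSemidef := Matrix.posSemidef_conjTranspose_mul_self Rs

/-- `‖G x‖ ≤ (Σ_{ij} ‖G i j‖)·‖x‖` (sup norms). [folklore] -/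
theorem norm_mulVec_le (G : Matrix κ ι ℂ) (x : ι → ℂ) : ‖G *ᵥ x‖ ≤ (∑ i, ∑ j, ‖G i j‖) * ‖x‖ := by
  refine (pi_norm_le_iff_of_nonneg (by positivity)).mpr fun i => ?_
  simp only [mulVec, dotProduct]
  calc ‖∑ j, G i j * x j‖ ≤ ∑ j, ‖G i j * x j‖ := norm_sum_le _ _
    _ ≤ ∑ j, ‖G i j‖ * ‖x‖ := Finset.sum_le_sum fun j _ => by
        rw [norm_mul]; exact mul_le_mul_of_nonneg_left (norm_le_pi_norm x j) (norm_nonneg _)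
    _ = (∑ j, ‖G i j‖) * ‖x‖ := by rw [Finset.sum_mul]
    _ ≤ (∑ i, ∑ j, ‖G i j‖) * ‖x‖ := mul_le_mul_of_nonneg_right (Finset.single_le_sum (f := fun i => ∑ j, ‖G i j‖)
        (fun i _ => Finset.sum_nonneg fun j _ => norm_nonneg _) (Finset.mem_univ i)) (norm_nonneg _)

/-- `‖x‖² ≤ re ⟨x, x⟩ = Σ_i ‖x i‖²` (the sup norm is below the Euclidean one; the identity is the tree's
`Literature.MathematicalPhysics.QuantumLattice.EigenvalueContinuation.re_star_dotProduct_self`, re-derived inline to keep the imports local). [folklore] -/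
theorem sq_norm_le_re_star_dotProduct_self (x : ι → ℂ) : ‖x‖ ^ 2 ≤ (star x ⬝ᵥ x).re := by
  have e : (star x ⬝ᵥ x).re = ∑ i, ‖x i‖ ^ 2 := by
    simp only [dotProduct, Pi.star_apply, Complex.star_def, Complex.conj_mul', Complex.re_sum, ← Complex.ofReal_pow, Complex.ofReal_re]
  rw [e]
  have h : ‖x‖ ≤ Real.sqrt (∑ i, ‖x i‖ ^ 2) := by
    refine (pi_norm_le_iff_of_nonneg (Real.sqrt_nonneg _)).mpr fun i => Real.le_sqrt_of_sq_le ?_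
    exact Finset.single_le_sum (f := fun j => ‖x j‖ ^ 2) (fun j _ => sq_nonneg _) (Finset.mem_univ i)
  calc ‖x‖ ^ 2 ≤ (Real.sqrt (∑ i, ‖x i‖ ^ 2)) ^ 2 := pow_le_pow_left₀ (norm_nonneg _) h 2
    _ = ∑ i, ‖x i‖ ^ 2 := Real.sq_sqrt (Finset.sum_nonneg fun i _ => sq_nonneg _)

end Norms

/-! ## §2 The correction onto the hard kernel -/

section Corr

variable {n ms mh : Type*} [Fintype n] [DecidableEq n] [Fintype ms] [Fintype mh] [DecidableEq mh]

/-- **INSIDE `ker R_h` THE CONSTRAINED PSEUDO-INVERSE OF A PSD WEIGHT `S` REPRODUCES `S v`**: `S (v − critCov S R_h (S v)) = 0` for `R_h v = 0`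
(`P S v = (P S P) v` lies in the range of the compressed form, orthogonal to its kernel; then `⟨u, S u⟩ = ⟨u, P S u⟩ = 0`). [folklore] -/
theorem weight_sub_critCov_eq_zero {S : Matrix n n ℂ} (hS : S.PosSemidef) (Rh : Matrix mh n ℂ) {v : n → ℂ} (hv : Rh *ᵥ v = 0) :
    S *ᵥ (v - critCov hS.isHermitian Rh *ᵥ (S *ᵥ v)) = 0 := by
  have hA : (kerProj Rh * S * kerProj Rh).IsHermitian := isHermitian_compress Rh hS.isHermitian
  have hPv : kerProj Rh *ᵥ v = v := kerProj_mulVec_of_mem_ker Rh hv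
  have horth : ∀ x, (kerProj Rh * S * kerProj Rh) *ᵥ x = 0 → star x ⬝ᵥ ((kerProj Rh * S * kerProj Rh) *ᵥ v) = 0 := by
    intro x hx
    have h := conj_pairing (kerProj Rh * S * kerProj Rh) x v
    rw [hA.eq, hx, star_zero, zero_dotProduct] at h; exact h.symm
  have key := mulVec_hpinv_mulVec_of_orth_ker hA horth
  simp only [← mulVec_mulVec] at key; rw [hPv] at key
  have hPSw : kerProj Rh *ᵥ (S *ᵥ (critCov hS.isHermitian Rh *ᵥ (S *ᵥ v))) = kerProj Rh *ᵥ (S *ᵥ v) := by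
    unfold critCov; simpa only [← mulVec_mulVec] using key
  set u := v - critCov hS.isHermitian Rh *ᵥ (S *ᵥ v) with hu
  have hRhu : Rh *ᵥ u = 0 := by rw [hu, mulVec_sub, hv, mulVec_critCov_mem_ker, sub_zero]
  have hPu : kerProj Rh *ᵥ u = u := kerProj_mulVec_of_mem_ker Rh hRhu
  have hPSu : kerProj Rh *ᵥ (S *ᵥ u) = 0 := by rw [hu, mulVec_sub, mulVec_sub, hPSw, sub_self]
  have hquad : star u ⬝ᵥ (S *ᵥ u) = 0 := by
    calc star u ⬝ᵥ (S *ᵥ u) = star (kerProj Rh *ᵥ u) ⬝ᵥ (S *ᵥ u) := by rw [hPu]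
      _ = star u ⬝ᵥ (kerProj Rh *ᵥ (S *ᵥ u)) := kerProj_pairing Rh u _
      _ = 0 := by rw [hPSu, dotProduct_zero]
  exact (hS.dotProduct_mulVec_zero_iff u).mp hquad

/-- **THE CORRECTION** `corr Rₛ R_h v := critCov (RₛᴴRₛ) R_h (RₛᴴRₛ v)`: subtracting it from `v ∈ ker R_h` lands in `ker Rₛ ∩ ker R_h`. [folklore] -/
def corr (Rs : Matrix ms n ℂ) (Rh : Matrix mh n ℂ) (v : n → ℂ) : n → ℂ :=
  critCov (weight_posSemidef Rs).isHermitian Rh *ᵥ ((Rsᴴ * Rs) *ᵥ v)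

/-- `corr` is a FIXED matrix applied to `Rₛ v`: `corr v = (critCov (RₛᴴRₛ) R_h · Rₛᴴ) (Rₛ v)`. [folklore] -/
theorem corr_eq_mulVec (Rs : Matrix ms n ℂ) (Rh : Matrix mh n ℂ) (v : n → ℂ) :
    corr Rs Rh v = (critCov (weight_posSemidef Rs).isHermitian Rh * Rsᴴ) *ᵥ (Rs *ᵥ v) := by
  rw [corr, ← mulVec_mulVec, ← mulVec_mulVec]

/-- `corr v` satisfies the hard constraints: `R_h (corr v) = 0`. [folklore] -/
theorem Rh_corr (Rs : Matrix ms n ℂ) (Rh : Matrix mh n ℂ) (v : n → ℂ) : Rh *ᵥ corr Rs Rh v = 0 :=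
  mulVec_critCov_mem_ker _ Rh _

/-- **`Rₛ (v − corr v) = 0` for `v ∈ ker R_h`.** [folklore] -/
theorem Rs_sub_corr (Rs : Matrix ms n ℂ) (Rh : Matrix mh n ℂ) {v : n → ℂ} (hv : Rh *ᵥ v = 0) : Rs *ᵥ (v - corr Rs Rh v) = 0 :=
  (conjTranspose_mul_self_mulVec_eq_zero Rs _).mp (weight_sub_critCov_eq_zero (weight_posSemidef Rs) Rh hv)

end Corr

/-! ## §3 The penalised family and the penalty-method limit -/

section Penalty

variable {n ms : Type*} [Fintype ms]

/-- **THE PENALISED FORM** `penForm H Rₛ a := H + a • RₛᴴRₛ` (the hard action `H` plus a Gaussian weight `a` on the soft rows `Rₛ`). [folklore] -/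
def penForm (H : Matrix n n ℂ) (Rs : Matrix ms n ℂ) (a : ℝ) : Matrix n n ℂ :=
  H + ((a : ℝ) : ℂ) • (Rsᴴ * Rs)

/-- The scaled weight is Hermitian. [folklore] -/
theorem smul_weight_isHermitian (Rs : Matrix ms n ℂ) (a : ℝ) : (((a : ℝ) : ℂ) • (Rsᴴ * Rs)).IsHermitian :=
  (Matrix.isHermitian_conjTranspose_mul_self Rs).smul (by rw [IsSelfAdjoint, Complex.star_def, Complex.conj_ofReal])

/-- `penForm` is Hermitian. [folklore] -/
theorem penForm_isHermitian {H : Matrix n n ℂ} (hH : H.IsHermitian) (Rs : Matrix ms n ℂ) (a : ℝ) : (penForm H Rs a).IsHermitian :=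
  hH.add (smul_weight_isHermitian Rs a)

variable [Fintype n]

/-- The scaled weight is PSD for `a ≥ 0`. [folklore] -/
theorem smul_weight_posSemidef (Rs : Matrix ms n ℂ) {a : ℝ} (ha : 0 ≤ a) : (((a : ℝ) : ℂ) • (Rsᴴ * Rs)).PosSemidef := by
  refine PosSemidef.of_dotProduct_mulVec_nonneg (smul_weight_isHermitian Rs a) fun v => ?_
  rw [smul_mulVec, dotProduct_smul, smul_eq_mul]
  exact mul_nonneg (Complex.zero_le_real.mpr ha) ((weight_posSemidef Rs).dotProduct_mulVec_nonneg v)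

/-- `penForm` is PSD for `a ≥ 0`. [folklore] -/
theorem penForm_posSemidef {H : Matrix n n ℂ} (hH : H.PosSemidef) (Rs : Matrix ms n ℂ) {a : ℝ} (ha : 0 ≤ a) :
    (penForm H Rs a).PosSemidef :=
  hH.add (smul_weight_posSemidef Rs ha)

/-- Loewner monotonicity in the weight: `penForm b − penForm a = (b − a) • RₛᴴRₛ ≥ 0` for `a ≤ b`. [folklore] -/
theorem penForm_mono (H : Matrix n n ℂ) (Rs : Matrix ms n ℂ) {a b : ℝ} (hab : a ≤ b) :
    (penForm H Rs b - penForm H Rs a).PosSemidef := by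
  have e : penForm H Rs b - penForm H Rs a = ((b - a : ℝ) : ℂ) • (Rsᴴ * Rs) := by
    rw [penForm, penForm, Complex.ofReal_sub, sub_smul]; abel
  rw [e]; exact smul_weight_posSemidef Rs (sub_nonneg.mpr hab)

/-- The zero modes of the penalised form are zero modes of `H` (`a ≥ 0`). [folklore] -/
theorem ker_of_penForm_ker {H : Matrix n n ℂ} (hH : H.PosSemidef) (Rs : Matrix ms n ℂ) {a : ℝ} (ha : 0 ≤ a) {z : n → ℂ}
    (hz : penForm H Rs a *ᵥ z = 0) : H *ᵥ z = 0 :=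
  ker_of_ker_larger hH (by rw [penForm, add_sub_cancel_left]; exact smul_weight_posSemidef Rs ha) hz

/-- The variational functionals of two weights differ by the slack: `qfun (penForm b) r v = qfun (penForm a) r v + (a − b)·‖Rₛv‖²`. [folklore] -/
theorem qfun_penForm (H : Matrix n n ℂ) (Rs : Matrix ms n ℂ) (a b : ℝ) (r v : n → ℂ) :
    qfun (penForm H Rs b) r v = qfun (penForm H Rs a) r v + ((a - b : ℝ) : ℂ) * (star (Rs *ᵥ v) ⬝ᵥ (Rs *ᵥ v)) := by
  have e : star v ⬝ᵥ ((Rsᴴ * Rs) *ᵥ v) = star (Rs *ᵥ v) ⬝ᵥ (Rs *ᵥ v) := by rw [← mulVec_mulVec, ← conj_pairing]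
  simp only [qfun, penForm, add_mulVec, smul_mulVec, dotProduct_add, dotProduct_smul, smul_eq_mul, e, Complex.ofReal_sub]
  ring

/-- The hard functional versus the penalised one: `qfun H r v = qfun (penForm a) r v + a·‖Rₛv‖²`. [folklore] -/
theorem qfun_base (H : Matrix n n ℂ) (Rs : Matrix ms n ℂ) (a : ℝ) (r v : n → ℂ) :
    qfun H r v = qfun (penForm H Rs a) r v + ((a : ℝ) : ℂ) * (star (Rs *ᵥ v) ⬝ᵥ (Rs *ᵥ v)) := by
  have e : star v ⬝ᵥ ((Rsᴴ * Rs) *ᵥ v) = star (Rs *ᵥ v) ⬝ᵥ (Rs *ᵥ v) := by rw [← mulVec_mulVec, ← conj_pairing]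
  simp only [qfun, penForm, add_mulVec, smul_mulVec, dotProduct_add, dotProduct_smul, smul_eq_mul, e]
  ring

variable [DecidableEq n] [DecidableEq ms] {mh : Type*} [Fintype mh] [DecidableEq mh]

/-- **THE PENALTY-METHOD LIMIT FOR THE CANONICAL CONSTRAINED COVARIANCE (pairings).**  `H` PSD (degenerate allowed), soft rows `Rₛ`, hard rows
`R_h`, a source `r` orthogonal to `ker H`.  Then `⟨r, critCov (H + a·RₛᴴRₛ) R_h r⟩ → ⟨r, critCov H (Rₛ ⊕ R_h) r⟩` as `a → ∞`: imposing the soft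
rows with an infinite Gaussian weight is imposing them hard. [folklore] -/
theorem pairing_critCov_penalty_tendsto {H : Matrix n n ℂ} (hH : H.PosSemidef) (Rs : Matrix ms n ℂ) (Rh : Matrix mh n ℂ)
    {r : n → ℂ} (hr : ∀ z, H *ᵥ z = 0 → star z ⬝ᵥ r = 0) :
    Tendsto (fun a : ℝ => star r ⬝ᵥ (critCov (penForm_isHermitian hH.isHermitian Rs a) Rh *ᵥ r)) atTop
      (𝓝 (star r ⬝ᵥ (critCov hH.isHermitian (Matrix.fromRows Rs Rh) *ᵥ r))) := by
  have hHa : ∀ {a : ℝ}, 0 ≤ a → (penForm H Rs a).PosSemidef := fun ha => penForm_posSemidef hH Rs ha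
  set Kh : Submodule ℂ (n → ℂ) := LinearMap.ker Rh.mulVecLin with hKh
  set K : Submodule ℂ (n → ℂ) := LinearMap.ker (Matrix.fromRows Rs Rh).mulVecLin with hK
  set v : ℝ → (n → ℂ) := fun a => critCov (penForm_isHermitian hH.isHermitian Rs a) Rh *ᵥ r with hv
  set vh : n → ℂ := critCov hH.isHermitian (Matrix.fromRows Rs Rh) *ᵥ r with hvh
  set p : ℝ → ℂ := fun a => star r ⬝ᵥ v a with hp
  set ph : ℂ := star r ⬝ᵥ vh with hph
  show Tendsto p atTop (𝓝 ph)
  have hleg : ∀ {a : ℝ}, 0 ≤ a → ∀ z, Rh *ᵥ z = 0 → penForm H Rs a *ᵥ z = 0 → star z ⬝ᵥ r = 0 :=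
    fun ha z _ hz => hr z (ker_of_penForm_ker hH Rs ha hz)
  have hlegh : ∀ z, Matrix.fromRows Rs Rh *ᵥ z = 0 → H *ᵥ z = 0 → star z ⬝ᵥ r = 0 := fun z _ hz => hr z hz
  have hcrit : ∀ {a : ℝ}, 0 ≤ a → IsCrit (penForm H Rs a) r Kh (v a) := fun ha => isCrit_critCov (hHa ha) Rh (hleg ha)
  have hcrith : IsCrit H r K vh := isCrit_critCov hH _ hlegh
  have hpa : ∀ {a : ℝ}, 0 ≤ a → qfun (penForm H Rs a) r (v a) = p a := fun ha => qfun_crit_eq_pairing (hcrit ha)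
  have hpH : qfun H r vh = ph := qfun_crit_eq_pairing hcrith
  have hvKh : ∀ a, v a ∈ Kh := fun a => critCov_mem_ker (penForm_isHermitian hH.isHermitian Rs a) Rh r
  have hvRh : ∀ a, Rh *ᵥ v a = 0 := fun a => mulVec_critCov_mem_ker (penForm_isHermitian hH.isHermitian Rs a) Rh r
  have hvh0 : Matrix.fromRows Rs Rh *ᵥ vh = 0 := mulVec_critCov_mem_ker hH.isHermitian (Matrix.fromRows Rs Rh) r
  have hvh_Rs : Rs *ᵥ vh = 0 := by funext i; simpa [Matrix.fromRows_mulVec] using congrFun hvh0 (Sum.inl i)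
  have hvh_Kh : vh ∈ Kh := by
    rw [hKh, mem_ker_iff]; funext i; simpa [Matrix.fromRows_mulVec] using congrFun hvh0 (Sum.inr i)
  have hlow : ∀ {a : ℝ}, 0 ≤ a → ph ≤ p a := by
    intro a ha
    calc ph = qfun H r vh := hpH.symm
      _ = qfun (penForm H Rs a) r vh := by rw [qfun_base H Rs a r vh, hvh_Rs]; simp
      _ ≤ qfun (penForm H Rs a) r (v a) := qfun_le_of_isCrit (hHa ha) (hcrit ha) hvh_Kh
      _ = p a := hpa ha
  have hanti : ∀ {a b : ℝ}, 0 ≤ a → a ≤ b → p b ≤ p a := by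
    intro a b ha hab
    have hb : 0 ≤ b := ha.trans hab
    calc p b = qfun (penForm H Rs b) r (v b) := (hpa hb).symm
      _ ≤ qfun (penForm H Rs a) r (v b) := qfun_mono_form (penForm_mono H Rs hab) r _
      _ ≤ qfun (penForm H Rs a) r (v a) := qfun_le_of_isCrit (hHa ha) (hcrit ha) (hvKh b)
      _ = p a := hpa ha
  set s : ℝ → ℂ := fun a => star (Rs *ᵥ v a) ⬝ᵥ (Rs *ᵥ v a) with hs
  have hsa : ∀ a, star (s a) = s a := fun a => (star_dotProduct _ _).symm
  have hslack : ∀ {a b : ℝ}, 0 ≤ b → b ≤ a → ((a - b : ℝ) : ℂ) * s a ≤ p b - p a := by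
    intro a b hb hba
    have ha : 0 ≤ a := hb.trans hba
    have h1 : qfun (penForm H Rs b) r (v a) ≤ p b := by
      rw [← hpa hb]; exact qfun_le_of_isCrit (hHa hb) (hcrit hb) (hvKh a)
    have h2 : qfun (penForm H Rs b) r (v a) = p a + ((a - b : ℝ) : ℂ) * s a := by rw [qfun_penForm H Rs a b, hpa ha]
    rw [h2] at h1
    exact le_sub_iff_add_le'.mpr h1
  have hcomp : ∀ {a : ℝ}, 0 ≤ a →
      p a - ph ≤ ((a : ℝ) : ℂ) * s a + star (corr Rs Rh (v a)) ⬝ᵥ (H *ᵥ corr Rs Rh (v a)) := by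
    intro a ha
    set w := corr Rs Rh (v a) with hw
    have hwRh : Rh *ᵥ w = 0 := Rh_corr Rs Rh (v a)
    have hRs0 : Rs *ᵥ (v a - w) = 0 := Rs_sub_corr Rs Rh (hvRh a)
    have hRsw : Rs *ᵥ w = Rs *ᵥ v a := by rw [mulVec_sub, sub_eq_zero] at hRs0; exact hRs0.symm
    have hmemK : v a - w ∈ K := by
      rw [hK, mem_ker_iff]; funext i; rcases i with i | i
      · rw [Matrix.fromRows_mulVec, Sum.elim_inl, hRs0]; rfl
      · rw [Matrix.fromRows_mulVec, Sum.elim_inr, mulVec_sub, hvRh a, hwRh, sub_zero]; rfl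
    have hwKh : w ∈ Kh := by rw [hKh, mem_ker_iff]; exact hwRh
    have hc1 : star w ⬝ᵥ (r - H *ᵥ v a) = ((a : ℝ) : ℂ) * s a := by
      have h := (hcrit ha).2 w hwKh
      rw [penForm, add_mulVec, smul_mulVec, ← sub_sub, dotProduct_sub, sub_eq_zero, dotProduct_smul, smul_eq_mul] at h
      rw [h, hs]; simp only
      rw [← mulVec_mulVec, ← conj_pairing Rs w (Rs *ᵥ v a), hRsw]
    have hc2 : star (r - H *ᵥ v a) ⬝ᵥ w = ((a : ℝ) : ℂ) * s a := by
      rw [star_dotProduct, hc1, star_mul', hsa a]; congr 1; exact Complex.conj_ofReal a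
    have hq1 : qfun H r (v a) = p a + ((a : ℝ) : ℂ) * s a := by rw [qfun_base H Rs a r (v a), hpa ha]
    have hq2 : qfun H r (v a - w) = p a - ((a : ℝ) : ℂ) * s a - star w ⬝ᵥ (H *ᵥ w) := by
      rw [sub_eq_add_neg (v a) w, qfun_add hH.isHermitian r (v a) (-w)]
      simp only [star_neg, neg_dotProduct, dotProduct_neg, mulVec_neg, neg_neg]
      rw [hc1, hc2, hq1]; ring
    have hle : qfun H r (v a - w) ≤ ph := by rw [← hpH]; exact qfun_le_of_isCrit hH hcrith hmemK
    rw [hq2, sub_sub, sub_le_iff_le_add] at hle; exact sub_le_iff_le_add'.mpr hle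
  set CH : ℝ := ∑ i, ∑ j, ‖H i j‖ with hCH
  set G : Matrix n ms ℂ := critCov (weight_posSemidef Rs).isHermitian Rh * Rsᴴ with hG
  set CG : ℝ := ∑ i, ∑ j, ‖G i j‖ with hCG
  have hCH0 : 0 ≤ CH := Finset.sum_nonneg fun i _ => Finset.sum_nonneg fun j _ => norm_nonneg _
  set C : ℝ := CH * CG ^ 2 with hC
  have hC0 : 0 ≤ C := by positivity
  have hquadR : ∀ a, (star (corr Rs Rh (v a)) ⬝ᵥ (H *ᵥ corr Rs Rh (v a))).re ≤ C * (s a).re := by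
    intro a
    have h2 : ‖corr Rs Rh (v a)‖ ≤ CG * ‖Rs *ᵥ v a‖ := by rw [corr_eq_mulVec]; exact norm_mulVec_le _ _
    calc (star (corr Rs Rh (v a)) ⬝ᵥ (H *ᵥ corr Rs Rh (v a))).re
        ≤ CH * ‖corr Rs Rh (v a)‖ ^ 2 := (Complex.re_le_norm _).trans (norm_quad_le H _)
      _ ≤ CH * (CG * ‖Rs *ᵥ v a‖) ^ 2 := mul_le_mul_of_nonneg_left (pow_le_pow_left₀ (norm_nonneg _) h2 2) hCH0
      _ = C * ‖Rs *ᵥ v a‖ ^ 2 := by rw [hC]; ring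
      _ ≤ C * (s a).re := mul_le_mul_of_nonneg_left (sq_norm_le_re_star_dotProduct_self _) hC0
  set P : ℝ → ℝ := fun a => (p a).re with hP
  set Ph : ℝ := ph.re with hPh
  have him : ∀ {a : ℝ}, 0 ≤ a → (p a).im = ph.im := fun ha => (Complex.le_def.mp (hlow ha)).2.symm
  have hPlow : ∀ {a : ℝ}, 0 ≤ a → Ph ≤ P a := fun ha => (Complex.le_def.mp (hlow ha)).1
  have hPanti : ∀ {a b : ℝ}, 0 ≤ a → a ≤ b → P b ≤ P a := fun ha hab => (Complex.le_def.mp (hanti ha hab)).1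
  have hσ0 : ∀ a, 0 ≤ (s a).re := fun a => (sq_nonneg ‖Rs *ᵥ v a‖).trans (sq_norm_le_re_star_dotProduct_self _)
  have hslackR : ∀ {a : ℝ}, 0 ≤ a → a / 2 * (s a).re ≤ P (a / 2) - P a := by
    intro a ha
    have h := (Complex.le_def.mp (hslack (a := a) (b := a / 2) (by linarith) (by linarith))).1
    rw [Complex.re_ofReal_mul, Complex.sub_re, show a - a / 2 = a / 2 by ring] at h
    exact h
  have hcompR : ∀ {a : ℝ}, 0 ≤ a → P a - Ph ≤ a * (s a).re + C * (s a).re := by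
    intro a ha
    have h := (Complex.le_def.mp (hcomp ha)).1
    rw [Complex.sub_re, Complex.add_re, Complex.re_ofReal_mul] at h
    exact h.trans (add_le_add le_rfl (hquadR a))
  have hkey : ∀ {a : ℝ}, 1 ≤ a → P a - Ph ≤ (2 + 2 * C) * (P (a / 2) - P a) := by
    intro a ha1
    have h1 := hslackR (a := a) (by linarith)
    have h2 := hcompR (a := a) (by linarith)
    have h3 : a * (s a).re ≤ 2 * (P (a / 2) - P a) := by
      calc a * (s a).re = 2 * (a / 2 * (s a).re) := by ring
        _ ≤ 2 * (P (a / 2) - P a) := by linarith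
    have h4 : (s a).re ≤ 2 * (P (a / 2) - P a) := by nlinarith [mul_nonneg (sub_nonneg.mpr ha1) (hσ0 a)]
    linarith [mul_le_mul_of_nonneg_left h4 hC0]
  have hPconv : ∀ ε > 0, ∃ A : ℝ, 1 ≤ A ∧ ∀ a, A ≤ a → P a - Ph < ε := by
    intro ε hε
    set Tset : Set ℝ := P '' Set.Ici 0 with hT
    have hTne : Tset.Nonempty := ⟨P 0, 0, Set.mem_Ici.mpr le_rfl, rfl⟩
    have hTbdd : BddBelow Tset := ⟨Ph, by rintro _ ⟨a, ha, rfl⟩; exact hPlow (Set.mem_Ici.mp ha)⟩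
    have h22 : 0 < 2 + 2 * C := by positivity
    obtain ⟨_, ⟨a₀, ha₀, rfl⟩, hlt⟩ := exists_lt_of_csInf_lt hTne (lt_add_of_pos_right (sInf Tset) (div_pos hε h22))
    refine ⟨max 1 (2 * a₀), le_max_left _ _, fun a ha => ?_⟩
    have ha1 : 1 ≤ a := (le_max_left _ _).trans ha
    have ha2 : a₀ ≤ a / 2 := by have h' := (le_max_right _ _).trans ha; linarith
    have hLa : sInf Tset ≤ P a := csInf_le hTbdd ⟨a, Set.mem_Ici.mpr (by linarith), rfl⟩
    have hΔ : P (a / 2) - P a < ε / (2 + 2 * C) := by linarith [hPanti (Set.mem_Ici.mp ha₀) ha2]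
    calc P a - Ph ≤ (2 + 2 * C) * (P (a / 2) - P a) := hkey ha1
      _ < (2 + 2 * C) * (ε / (2 + 2 * C)) := mul_lt_mul_of_pos_left hΔ h22
      _ = ε := by field_simp
  rw [Metric.tendsto_atTop]
  intro ε hε
  obtain ⟨A, hA1, hA⟩ := hPconv ε hε
  refine ⟨A, fun a ha => ?_⟩
  have ha0 : 0 ≤ a := by linarith
  have heq : p a - ph = ((P a - Ph : ℝ) : ℂ) := by
    apply Complex.ext
    · rw [Complex.sub_re, Complex.ofReal_re]
    · rw [Complex.sub_im, him ha0, sub_self, Complex.ofReal_im]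
  rw [dist_eq_norm, heq, Complex.norm_real, Real.norm_eq_abs, abs_lt]
  constructor <;> linarith [hPlow ha0, hA a ha]

variable {τ : Type*} [Fintype τ] [DecidableEq τ]

/-- **THE PENALTY-METHOD LIMIT FOR THE READ-OUT MATRICES**: `H` PSD (degenerate allowed), rows `Rₛ, R_h`, a test matrix `T` killing `ker H`.
Then `T·critCov (H + a·RₛᴴRₛ) R_h·Tᴴ → T·critCov H (Rₛ ⊕ R_h)·Tᴴ` entry by entry as `a → ∞`. [folklore] -/
theorem readOut_critCov_penalty_tendsto {H : Matrix n n ℂ} (hH : H.PosSemidef) (Rs : Matrix ms n ℂ) (Rh : Matrix mh n ℂ)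
    (T : Matrix τ n ℂ) (hT : ∀ z, H *ᵥ z = 0 → T *ᵥ z = 0) (i j : τ) :
    Tendsto (fun a : ℝ => (T * critCov (penForm_isHermitian hH.isHermitian Rs a) Rh * Tᴴ) i j) atTop
      (𝓝 ((T * critCov hH.isHermitian (Matrix.fromRows Rs Rh) * Tᴴ) i j)) := by
  have hleg : ∀ u : τ → ℂ, ∀ z, H *ᵥ z = 0 → star z ⬝ᵥ (Tᴴ *ᵥ u) = 0 := by
    intro u z hz; rw [← conj_pairing, hT z hz, star_zero, zero_dotProduct]
  have hq : ∀ u : τ → ℂ, Tendsto (fun a : ℝ => star u ⬝ᵥ ((T * critCov (penForm_isHermitian hH.isHermitian Rs a) Rh * Tᴴ) *ᵥ u))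
      atTop (𝓝 (star u ⬝ᵥ ((T * critCov hH.isHermitian (Matrix.fromRows Rs Rh) * Tᴴ) *ᵥ u))) := by
    intro u; simp only [readOut_quad]; exact pairing_critCov_penalty_tendsto hH Rs Rh (hleg u)
  simp only [readOut_apply_polar T]
  refine Tendsto.div_const (Tendsto.sub ?_ (Tendsto.const_mul _ ?_)) 2
  · exact ((hq _).sub (hq _)).sub (hq _)
  · exact ((hq _).sub (hq _)).sub (hq _)

end Penalty

/-! ## §4 The torus: the hard averaging constraint is the infinite-weight limit of the Gaussian one -/

section Torus

variable {d : ℕ} (Lc : ℕ) [NeZero Lc] (M : Fin d → ℕ) [hM : ∀ μ, NeZero (M μ)]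
variable {cs ch : Type*} [Fintype cs] [DecidableEq cs] [Fintype ch] [DecidableEq ch]

omit [DecidableEq cs] in
/-- `softPlaqCov` read through the penalised family. [folklore] -/
theorem softPlaqCov_eq_readOut_penForm (k : ℕ) (Rs : Matrix cs (Tor M × Fin d) ℂ) (a' : ℝ) (Rh : Matrix ch (Tor M × Fin d) ℂ) :
    softPlaqCov Lc M k Rs a' Rh
      = curlMat M * critCov (penForm_isHermitian (effAction_isHermitian Lc M k) Rs a') Rh * (curlMat M)ᴴ := by
  rw [softPlaqCov, critCov_congr (softForm_isHermitian Lc M k Rs a') (penForm_isHermitian (effAction_isHermitian Lc M k) Rs a') rfl]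

/-- **THE HARD CONSTRAINT IS THE `a′ → ∞` LIMIT OF THE SOFT ONE**: for every level `k`, soft rows `Rₛ`, hard rows `R_h`, read-out torus and
entry, `softPlaqCov k Rₛ a′ R_h i j → plaqCov (Rₛ ⊕ R_h) k i j` as `a′ → ∞` — the plaquette content of the fluctuation covariance under Bałaban's
block action with a Gaussian weight `a′` on the next averaging converges to the one with that averaging imposed by δ-functions; NO rate. [folklore] -/
theorem softPlaqCov_tendsto_plaqCov_hardRows (k : ℕ) (Rs : Matrix cs (Tor M × Fin d) ℂ) (Rh : Matrix ch (Tor M × Fin d) ℂ)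
    (i j : Fin d × Fin d × Tor M) :
    Tendsto (fun a' : ℝ => softPlaqCov Lc M k Rs a' Rh i j) atTop (𝓝 (plaqCov Lc M (Matrix.fromRows Rs Rh) k i j)) := by
  simp only [softPlaqCov_eq_readOut_penForm, plaqCov_eq_critCov_effAction]
  exact readOut_critCov_penalty_tendsto (effAction_posSemidef Lc M k) Rs Rh (curlMat M)
    (fun z hz => curlMat_of_effAction_ker Lc M k hz) i j

/-- **THE HARD PLAQUETTE COVARIANCE IS THE GREATEST LOWER BOUND OF THE SOFT ONES**: a matrix below `softPlaqCov k Rₛ a′ R_h` for every `a′ ≥ 0`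
is below `plaqCov (Rₛ ⊕ R_h) k` (Loewner); with `MonotoneTorusSoft.plaqCov_hardRows_le_softPlaqCov` the hard one IS the infimum. [folklore] -/
theorem le_plaqCov_hardRows_of_le_soft (k : ℕ) (Rs : Matrix cs (Tor M × Fin d) ℂ) (Rh : Matrix ch (Tor M × Fin d) ℂ)
    {B : Matrix (Fin d × Fin d × Tor M) (Fin d × Fin d × Tor M) ℂ}
    (hB : ∀ a' : ℝ, 0 ≤ a' → (softPlaqCov Lc M k Rs a' Rh - B).PosSemidef) :
    (plaqCov Lc M (Matrix.fromRows Rs Rh) k - B).PosSemidef := by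
  refine posSemidef_of_tendsto (G := fun m : ℕ => softPlaqCov Lc M k Rs (m : ℝ) Rh - B) (fun m => hB m (Nat.cast_nonneg m)) fun a b => ?_
  simp only [Matrix.sub_apply]
  exact ((softPlaqCov_tendsto_plaqCov_hardRows Lc M k Rs Rh a b).comp tendsto_natCast_atTop_atTop).sub tendsto_const_nhds

end Torus

end Summit.QuantumFields.BalabanUV.Beta.GAN24.MonotoneTorusSoftLimit
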